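import Summits.Ventures.HSemireg.ObstructionLocusLocalExtDerived

/-!
# Venture HSemireg — (S5) OBSTRUCTION LOCUS away from secant type, XXXI: `Ext` TOOLS for EXT-NOTE §6.B(c) at a crossing
# germ — connecting-map cokernels, `Ext` on finite powers, scalar matrices

HONEST FRAMING.  Part of the Lean side of the computation cell `pub-hsemireg` (track «S4-PUSH» (ii), seat
s4-prove-2).  GENERIC homological / linear algebra in `ModuleCat A`, `A` any commutative ring, with Mathlib's derived
`CategoryTheory.Abelian.Ext`.  Nothing here constructs a variety or a sheaf; nothing here says that HC / HC_CM / HC_AV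
holds; no Literature fact is declared or used; no object is certified.
The first tools of the Künneth-free route to EXT-NOTE §6.B(c) at a CROSSING germ (`𝓔xt²` of the ideal of a two-block
model with itself; files XXXII–XXXV):

* COKERNELS.  For a short exact `0 → X₁ →f X₂ →g X₃ → 0` and `N` with `Ext^{k+1}(X₂, N) = 0`:
  `extPrecomp` (`f^*`), `extConnecting` (`∂ = [S] · −`), `range_extPrecomp_eq_ker_extConnecting`,
  `extConnecting_surjective`, **`extCokernelEquiv : Ext^k(X₁, N) ⧸ range f^* ≃ₗ[A] Ext^{k+1}(X₃, N)`**; and the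
  covariant twin for `Ext^{k+1}(X, X₁) = 0`: `extPostcomp` (`f_*`), `extPostcompG` (`g_*`),
  **`extCokernelEquiv' : Ext^k(X, X₂) ⧸ range f_* ≃ₗ[A] Ext^k(X, X₃)`**.
* FINITE POWERS.  `extPiEquiv : Ext^k(M^T, N) ≃ₗ[A] (T → Ext^k(M, N))`, `extCoPiEquiv : Ext^k(X, M^T) ≃ₗ[A]
  (T → Ext^k(X, M))`; `scalarMatrix c : M^{T₁} →ₗ M^{T₂}`; **`extPiEquiv_precomp_scalarMatrix`** (`[Φ]^*` is the
  transpose matrix on components), **`extCoPiEquiv_postcomp_scalarMatrix`** (`[Φ]_*` is the matrix on components);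
  `compLeft₂` — entrywise maps on doubly indexed families.
References (dictionary only): EXT-NOTE.md §6.B(c).
-/

open CategoryTheory CategoryTheory.Abelian
open scoped BigOperators

universe u

namespace Summit.Ventures.HSemireg.ObstructionLocus

/-! ## Connecting-map cokernels (contravariant) -/

section Contra

variable {A : Type u} [CommRing A] {S : ShortComplex (ModuleCat.{u} A)} (hS : S.ShortExact)
  (N : ModuleCat.{u} A) (k : ℕ)

/-- `f^* : Ext^k(X₂, N) →ₗ[A] Ext^k(X₁, N)`, precomposition with `[f] ∈ Ext⁰(X₁, X₂)`. -/
noncomputable def extPrecomp : Ext.{u} S.X₂ N k →ₗ[A] Ext.{u} S.X₁ N k :=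
  Ext.bilinearCompOfLinear A S.X₁ S.X₂ N 0 k k (zero_add k) (Ext.mk₀ S.f)

/-- The formula for `f^*`. -/
theorem extPrecomp_apply (x : Ext.{u} S.X₂ N k) :
    extPrecomp (S := S) N k x = (Ext.mk₀ S.f).comp x (zero_add k) := rfl

/-- `∂ : Ext^k(X₁, N) →ₗ[A] Ext^{k+1}(X₃, N)`, the Yoneda product with the class `[S] ∈ Ext¹(X₃, X₁)` of the extension. -/
noncomputable def extConnecting : Ext.{u} S.X₁ N k →ₗ[A] Ext.{u} S.X₃ N (k + 1) :=
  Ext.bilinearCompOfLinear A S.X₃ S.X₁ N 1 k (k + 1) (Nat.add_comm 1 k) hS.extClass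

/-- The formula for `∂`. -/
theorem extConnecting_apply (η : Ext.{u} S.X₁ N k) :
    extConnecting hS N k η = hS.extClass.comp η (Nat.add_comm 1 k) := rfl

/-- `∂ ∘ f^* = 0`. -/
theorem extConnecting_extPrecomp (x : Ext.{u} S.X₂ N k) :
    extConnecting hS N k (extPrecomp N k x) = 0 := by
  rw [extConnecting_apply, extPrecomp_apply]
  exact hS.extClass_comp_assoc x

/-- **Exactness at `Ext^k(X₁, N)`**: `range f^* = ker ∂`. -/
theorem range_extPrecomp_eq_ker_extConnecting :
    LinearMap.range (extPrecomp (S := S) N k) = LinearMap.ker (extConnecting hS N k) := by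
  apply le_antisymm
  · rintro _ ⟨x, rfl⟩
    exact extConnecting_extPrecomp hS N k x
  · intro η hη
    rw [LinearMap.mem_ker, extConnecting_apply] at hη
    obtain ⟨x, hx⟩ := Ext.contravariant_sequence_exact₁ hS N η (Nat.add_comm 1 k) hη
    exact ⟨x, hx⟩

/-- **`∂` is onto when `Ext^{k+1}(X₂, N) = 0`.** -/
theorem extConnecting_surjective (hN : ∀ e : Ext.{u} S.X₂ N (k + 1), e = 0) :
    Function.Surjective (extConnecting hS N k) := by
  intro x₃
  obtain ⟨η, hη⟩ := Ext.contravariant_sequence_exact₃ hS N x₃ (hN _) (Nat.add_comm 1 k)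
  exact ⟨η, hη⟩

/-- **`Ext^k(X₁, N) ⧸ range f^* ≃ₗ[A] Ext^{k+1}(X₃, N)`** when `Ext^{k+1}(X₂, N) = 0`, induced by `∂`. -/
noncomputable def extCokernelEquiv (hN : ∀ e : Ext.{u} S.X₂ N (k + 1), e = 0) :
    (Ext.{u} S.X₁ N k ⧸ LinearMap.range (extPrecomp (S := S) N k)) ≃ₗ[A] Ext.{u} S.X₃ N (k + 1) :=
  (Submodule.quotEquivOfEq _ _ (range_extPrecomp_eq_ker_extConnecting hS N k)).trans
    (LinearMap.quotKerEquivOfSurjective _ (extConnecting_surjective hS N k hN))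

/-- The evaluation formula: the class of `η` goes to `∂ η = [S] · η`. -/
theorem extCokernelEquiv_mk (hN : ∀ e : Ext.{u} S.X₂ N (k + 1), e = 0) (η : Ext.{u} S.X₁ N k) :
    extCokernelEquiv hS N k hN (Submodule.Quotient.mk η) = hS.extClass.comp η (Nat.add_comm 1 k) := by
  simp [extCokernelEquiv, extConnecting_apply]


end Contra

/-! ## Connecting-map cokernels (covariant) -/

section Co

variable {A : Type u} [CommRing A] {S : ShortComplex (ModuleCat.{u} A)} (hS : S.ShortExact)
  (X : ModuleCat.{u} A) (k : ℕ)

/-- `f_* : Ext^k(X, X₁) →ₗ[A] Ext^k(X, X₂)`. -/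
noncomputable def extPostcomp : Ext.{u} X S.X₁ k →ₗ[A] Ext.{u} X S.X₂ k :=
  (Ext.bilinearCompOfLinear A X S.X₁ S.X₂ k 0 k (add_zero k)).flip (Ext.mk₀ S.f)

/-- The formula for `f_*`. -/
theorem extPostcomp_apply (x : Ext.{u} X S.X₁ k) :
    extPostcomp (S := S) X k x = x.comp (Ext.mk₀ S.f) (add_zero k) := rfl

/-- `g_* : Ext^k(X, X₂) →ₗ[A] Ext^k(X, X₃)`. -/
noncomputable def extPostcompG : Ext.{u} X S.X₂ k →ₗ[A] Ext.{u} X S.X₃ k :=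
  (Ext.bilinearCompOfLinear A X S.X₂ S.X₃ k 0 k (add_zero k)).flip (Ext.mk₀ S.g)

/-- The formula for `g_*`. -/
theorem extPostcompG_apply (x : Ext.{u} X S.X₂ k) :
    extPostcompG (S := S) X k x = x.comp (Ext.mk₀ S.g) (add_zero k) := rfl

/-- `g_* ∘ f_* = 0`. -/
theorem extPostcompG_extPostcomp (x : Ext.{u} X S.X₁ k) :
    extPostcompG X k (extPostcomp X k x) = 0 := by
  rw [extPostcompG_apply, extPostcomp_apply, Ext.comp_assoc_of_third_deg_zero, Ext.mk₀_comp_mk₀, S.zero,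
    Ext.mk₀_zero, Ext.comp_zero]

include hS in
/-- **Exactness at `Ext^k(X, X₂)`**: `range f_* = ker g_*`. -/
theorem range_extPostcomp_eq_ker_extPostcompG :
    LinearMap.range (extPostcomp (S := S) X k) = LinearMap.ker (extPostcompG (S := S) X k) := by
  apply le_antisymm
  · rintro _ ⟨x, rfl⟩
    exact extPostcompG_extPostcomp X k x
  · intro η hη
    rw [LinearMap.mem_ker, extPostcompG_apply] at hη
    obtain ⟨x, hx⟩ := Ext.covariant_sequence_exact₂ X hS η hη
    exact ⟨x, hx⟩

include hS in
/-- **`g_*` is onto when `Ext^{k+1}(X, X₁) = 0`.** -/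
theorem extPostcompG_surjective (hX : ∀ e : Ext.{u} X S.X₁ (k + 1), e = 0) :
    Function.Surjective (extPostcompG (S := S) X k) := by
  intro x₃
  obtain ⟨η, hη⟩ := Ext.covariant_sequence_exact₃ X hS x₃ rfl (hX _)
  exact ⟨η, hη⟩

/-- **`Ext^k(X, X₂) ⧸ range f_* ≃ₗ[A] Ext^k(X, X₃)`** when `Ext^{k+1}(X, X₁) = 0`, induced by `g_*`. -/
noncomputable def extCokernelEquiv' (hX : ∀ e : Ext.{u} X S.X₁ (k + 1), e = 0) :
    (Ext.{u} X S.X₂ k ⧸ LinearMap.range (extPostcomp (S := S) X k)) ≃ₗ[A] Ext.{u} X S.X₃ k :=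
  (Submodule.quotEquivOfEq _ _ (range_extPostcomp_eq_ker_extPostcompG hS X k)).trans
    (LinearMap.quotKerEquivOfSurjective _ (extPostcompG_surjective hS X k hX))

/-- The evaluation formula: the class of `η` goes to `g_* η = η · [g]`. -/
theorem extCokernelEquiv'_mk (hX : ∀ e : Ext.{u} X S.X₁ (k + 1), e = 0) (η : Ext.{u} X S.X₂ k) :
    extCokernelEquiv' hS X k hX (Submodule.Quotient.mk η) = η.comp (Ext.mk₀ S.g) (add_zero k) := by
  simp [extCokernelEquiv', extPostcompG_apply]

end Co

/-! ## `Ext` on finite powers and scalar matrices -/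

section Powers

variable {A : Type u} [CommRing A] (M : Type u) [AddCommGroup M] [Module A M]
  (T : Type) [DecidableEq T]

/-- The inclusion of the `a`-th factor, as a morphism `M ⟶ M^T` of `ModuleCat A`. -/
noncomputable abbrev singleHom (a : T) : ModuleCat.of A M ⟶ ModuleCat.of A (T → M) :=
  ModuleCat.ofHom (LinearMap.single A (fun _ : T => M) a)

/-- The `a`-th projection, as a morphism `M^T ⟶ M` of `ModuleCat A`. -/
noncomputable abbrev projHom (a : T) : ModuleCat.of A (T → M) ⟶ ModuleCat.of A M :=
  ModuleCat.ofHom (LinearMap.proj a)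

/-- `ι_a ≫ pr_a = 𝟙`. -/
theorem singleHom_comp_projHom_self (a : T) :
    singleHom M T a ≫ projHom M T a = 𝟙 (ModuleCat.of A M) := by
  apply ModuleCat.hom_ext
  apply LinearMap.ext
  intro m
  simp

/-- `ι_a ≫ pr_b = 0` for `a ≠ b`. -/
theorem singleHom_comp_projHom_of_ne {a b : T} (h : a ≠ b) :
    (singleHom M T a ≫ projHom M T b : ModuleCat.of A M ⟶ ModuleCat.of A M) = 0 := by
  apply ModuleCat.hom_ext
  apply LinearMap.ext
  intro m
  simp [Ne.symm h]

/-- `Σ_a pr_a ≫ ι_a = 𝟙`. -/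
theorem sum_projHom_comp_singleHom [Fintype T] :
    ∑ a : T, projHom M T a ≫ singleHom M T a = 𝟙 (ModuleCat.of A (T → M)) := by
  apply ModuleCat.hom_ext
  rw [ModuleCat.hom_id, ModuleCat.hom_sum]
  apply LinearMap.ext
  intro x
  rw [LinearMap.id_apply, LinearMap.sum_apply]
  conv_rhs => rw [← Finset.univ_sum_single x]
  refine Finset.sum_congr rfl fun a _ => ?_
  rfl

section Contravariant

variable [Fintype T] (N : ModuleCat.{u} A) (k : ℕ)

/-- **`Ext^k(M^T, N) ≃ₗ[A] (T → Ext^k(M, N))`**: `Ext` turns a finite power in the first variable into a product. -/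
noncomputable def extPiEquiv :
    Ext.{u} (ModuleCat.of A (T → M)) N k ≃ₗ[A] (T → Ext.{u} (ModuleCat.of A M) N k) where
  toFun ζ a := (Ext.mk₀ (singleHom M T a)).comp ζ (zero_add k)
  invFun η := ∑ a, (Ext.mk₀ (projHom M T a)).comp (η a) (zero_add k)
  map_add' ζ ζ' := by
    funext a
    simp only [Ext.comp_add, Pi.add_apply]
  map_smul' r ζ := by
    funext a
    simp only [Ext.comp_smul, Pi.smul_apply, RingHom.id_apply]
  left_inv ζ := by
    simp only [Ext.mk₀_comp_mk₀_assoc, ← Ext.sum_comp, ← Ext.mk₀_sum, sum_projHom_comp_singleHom,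
      Ext.mk₀_id_comp]
  right_inv η := by
    funext b
    simp only [Ext.comp_sum, Ext.mk₀_comp_mk₀_assoc]
    rw [Finset.sum_eq_single b, singleHom_comp_projHom_self, Ext.mk₀_id_comp]
    · intro a _ hab
      rw [singleHom_comp_projHom_of_ne M T (Ne.symm hab), Ext.mk₀_zero, Ext.zero_comp]
    · intro h; exact absurd (Finset.mem_univ b) h

/-- The components of `extPiEquiv`. -/
theorem extPiEquiv_apply (ζ : Ext.{u} (ModuleCat.of A (T → M)) N k) (a : T) :
    extPiEquiv M T N k ζ a = (Ext.mk₀ (singleHom M T a)).comp ζ (zero_add k) := rfl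

/-- The inverse of `extPiEquiv`. -/
theorem extPiEquiv_symm_apply (η : T → Ext.{u} (ModuleCat.of A M) N k) :
    (extPiEquiv M T N k).symm η = ∑ a, (Ext.mk₀ (projHom M T a)).comp (η a) (zero_add k) := rfl

end Contravariant

section Covariant

variable [Fintype T] (X : ModuleCat.{u} A) (k : ℕ)

/-- **`Ext^k(X, M^T) ≃ₗ[A] (T → Ext^k(X, M))`**: `Ext` turns a finite power in the second variable into a product. -/
noncomputable def extCoPiEquiv :
    Ext.{u} X (ModuleCat.of A (T → M)) k ≃ₗ[A] (T → Ext.{u} X (ModuleCat.of A M) k) where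
  toFun ζ a := ζ.comp (Ext.mk₀ (projHom M T a)) (add_zero k)
  invFun η := ∑ a, (η a).comp (Ext.mk₀ (singleHom M T a)) (add_zero k)
  map_add' ζ ζ' := by
    funext a
    simp only [Ext.add_comp, Pi.add_apply]
  map_smul' r ζ := by
    funext a
    simp only [Ext.smul_comp, Pi.smul_apply, RingHom.id_apply]
  left_inv ζ := by
    simp only [Ext.comp_assoc_of_third_deg_zero, Ext.mk₀_comp_mk₀, ← Ext.comp_sum, ← Ext.mk₀_sum,
      sum_projHom_comp_singleHom, Ext.comp_mk₀_id]
  right_inv η := by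
    funext b
    simp only [Ext.sum_comp, Ext.comp_assoc_of_third_deg_zero, Ext.mk₀_comp_mk₀]
    rw [Finset.sum_eq_single b, singleHom_comp_projHom_self, Ext.comp_mk₀_id]
    · intro a _ hab
      rw [singleHom_comp_projHom_of_ne M T hab, Ext.mk₀_zero, Ext.comp_zero]
    · intro h; exact absurd (Finset.mem_univ b) h

/-- The components of `extCoPiEquiv`. -/
theorem extCoPiEquiv_apply (ζ : Ext.{u} X (ModuleCat.of A (T → M)) k) (a : T) :
    extCoPiEquiv M T X k ζ a = ζ.comp (Ext.mk₀ (projHom M T a)) (add_zero k) := rfl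

/-- The inverse of `extCoPiEquiv`. -/
theorem extCoPiEquiv_symm_apply (η : T → Ext.{u} X (ModuleCat.of A M) k) :
    (extCoPiEquiv M T X k).symm η = ∑ a, (η a).comp (Ext.mk₀ (singleHom M T a)) (add_zero k) := rfl

end Covariant

/-! ## Scalar matrices and their action on `Ext` -/

section Matrix

variable {M T} {T₁ T₂ : Type}

variable (M) in
/-- The scalar matrix `c : T₂ → T₁ → A` as an `A`-linear map `M^{T₁} → M^{T₂}`: `(Φ v)_b = Σ_a c b a • v a`. -/
noncomputable def scalarMatrix [Fintype T₁] (c : T₂ → T₁ → A) : (T₁ → M) →ₗ[A] (T₂ → M) :=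
  LinearMap.pi fun b => ∑ a, c b a • LinearMap.proj a

/-- The entries of `scalarMatrix c v`. -/
theorem scalarMatrix_apply [Fintype T₁] (c : T₂ → T₁ → A) (v : T₁ → M) (b : T₂) :
    scalarMatrix M c v b = ∑ a, c b a • v a := by
  simp [scalarMatrix, LinearMap.sum_apply]

/-- `ι_a ≫ Φ = Σ_b c b a • ι_b`. -/
theorem singleHom_comp_scalarMatrix [Fintype T₁] [DecidableEq T₁] [Fintype T₂] [DecidableEq T₂]
    (c : T₂ → T₁ → A) (a : T₁) :
    singleHom M T₁ a ≫ ModuleCat.ofHom (scalarMatrix M c) = ∑ b, c b a • singleHom M T₂ b := by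
  apply ModuleCat.hom_ext
  rw [ModuleCat.hom_sum]
  apply LinearMap.ext
  intro m
  funext b
  have lhs : scalarMatrix M c (Pi.single a m) b = c b a • m := by
    rw [scalarMatrix_apply, Finset.sum_eq_single a]
    · simp
    · intro a' _ ha'; simp [ha']
    · intro h; exact absurd (Finset.mem_univ a) h
  have rhs : (∑ b' : T₂, c b' a • (Pi.single b' m : T₂ → M)) b = c b a • m := by
    rw [Finset.sum_apply, Finset.sum_eq_single b]
    · simp
    · intro b' _ hb'; simp [Ne.symm hb']
    · intro h; exact absurd (Finset.mem_univ b) h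
  simpa [LinearMap.sum_apply] using lhs.trans rhs.symm

/-- `Φ ≫ pr_b = Σ_a c b a • pr_a`. -/
theorem scalarMatrix_comp_projHom [Fintype T₁] [DecidableEq T₁] [DecidableEq T₂] (c : T₂ → T₁ → A) (b : T₂) :
    ModuleCat.ofHom (scalarMatrix M c) ≫ projHom M T₂ b = ∑ a, c b a • projHom M T₁ a := by
  apply ModuleCat.hom_ext
  rw [ModuleCat.hom_sum]
  apply LinearMap.ext
  intro v
  rw [ModuleCat.hom_comp, LinearMap.comp_apply, ModuleCat.hom_ofHom, ModuleCat.hom_ofHom, LinearMap.proj_apply,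
    scalarMatrix_apply, LinearMap.sum_apply]
  refine Finset.sum_congr rfl fun a _ => ?_
  simp

variable [Fintype T₁] [DecidableEq T₁] [Fintype T₂] [DecidableEq T₂] (N X : ModuleCat.{u} A) (k : ℕ)

/-- **`[Φ]^*` is the TRANSPOSE matrix on components**: for `ζ ∈ Ext^k(M^{T₂}, N)`,
`([Φ] · ζ)_a = Σ_b c b a • ζ_b`. -/
theorem extPiEquiv_precomp_scalarMatrix (c : T₂ → T₁ → A)
    (ζ : Ext.{u} (ModuleCat.of A (T₂ → M)) N k) (a : T₁) :
    extPiEquiv M T₁ N k ((Ext.mk₀ (ModuleCat.ofHom (scalarMatrix M c))).comp ζ (zero_add k)) a =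
      ∑ b, c b a • extPiEquiv M T₂ N k ζ b := by
  simp only [extPiEquiv_apply, Ext.mk₀_comp_mk₀_assoc, singleHom_comp_scalarMatrix, Ext.mk₀_sum, Ext.mk₀_smul,
    Ext.sum_comp, Ext.smul_comp]

/-- **`[Φ]_*` is the matrix on components**: for `ζ ∈ Ext^k(X, M^{T₁})`, `(ζ · [Φ])_b = Σ_a c b a • ζ_a`. -/
theorem extCoPiEquiv_postcomp_scalarMatrix (c : T₂ → T₁ → A)
    (ζ : Ext.{u} X (ModuleCat.of A (T₁ → M)) k) (b : T₂) :
    extCoPiEquiv M T₂ X k (ζ.comp (Ext.mk₀ (ModuleCat.ofHom (scalarMatrix M c))) (add_zero k)) b =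
      ∑ a, c b a • extCoPiEquiv M T₁ X k ζ a := by
  simp only [extCoPiEquiv_apply, Ext.comp_assoc_of_third_deg_zero, Ext.mk₀_comp_mk₀, scalarMatrix_comp_projHom,
    Ext.mk₀_sum, Ext.mk₀_smul, Ext.comp_sum, Ext.comp_smul]

end Matrix


end Powers

/-! ## Entrywise maps on doubly indexed families -/

section CompLeft₂

variable {A : Type u} [CommRing A] {T₁ T₂ : Type} {N N' : Type u} [AddCommGroup N] [Module A N]
  [AddCommGroup N'] [Module A N']

/-- Entrywise application of a linear map on `N^{T₁ × T₂}`. -/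
abbrev compLeft₂ (θ : N →ₗ[A] N') : (T₁ → T₂ → N) →ₗ[A] (T₁ → T₂ → N') :=
  (θ.compLeft T₂).compLeft T₁

/-- The entries of `compLeft₂ θ f`. -/
theorem compLeft₂_apply (θ : N →ₗ[A] N') (f : T₁ → T₂ → N) (i : T₁) (j : T₂) :
    compLeft₂ θ f i j = θ (f i j) := rfl

end CompLeft₂

end Summit.Ventures.HSemireg.ObstructionLocus
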